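import Mathlib
import HarnessLib
import Summits.HubbardSuperconductivity.HubbardSuperconductivity.Theorems.KLProgrammeH10TwoPointLimitPerturbedCountLipschitz
import Summits.HubbardSuperconductivity.HubbardSuperconductivity.Theorems.KLProgrammeH10TwoPointLimitPerturbedCountPeriodicDeriv

/-!
# Route `KLProgramme` — K3 engine child `KLRegimeEngineV17F2` (stmt-HubbardSuperconductivity-20437), stub (b) import ι₂:
# level counts of the PERTURBED diagonal function on its transversal rows (no `√η` term)

Cell gate-hubbard-kl, plan g17 (R41)(i) «E1-P2-THIN-COUNT» (seat p4; plan HOME/prover-p4/E1-P2-THIN-COUNT-PLAN.md «(F3c) intended statement», class (T)).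
Perturbed-curve twin of `BandSectorCounting.count_levels_diag_transversal` (`ThinSectorFoldTransversalLevels`): lemma L2 of the Toolbox for the perturbed
diagonal function `D(x) = h^E_P(x, x)` (`D′ = 2∂₃h^E`, `hasDerivAt_hfunE_diagZero`; `D′` is `A_E`-Lipschitz by `hasDerivAt_two_h3E_diag` + `abs_diag_deriv2E_le`).

* `abs_two_h3E_diag_sub_le`, `count_levels_diagE_transversal`.

Everything is PROVED; no definitions.  References: BGM 2006 Lemma 3.1 / App. A2 [cite: BenfattoGiulianiMastropietro2006]; Mastropietro 2008 (14.67) p. 223,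
p. 229 [cite: Mastropietro2008].
-/

noncomputable section

namespace Summit.HubbardSuperconductivity.HubbardSuperconductivity.Theorems.PerturbedFermiCurve

set_option linter.dupNamespace false -- summit = problem name (single-conjunct summit), D-0017

open Real Set
open Literature.MathematicalPhysics.QuantumLattice Literature.MathematicalPhysics.QuantumLattice.BandSectorCounting

section TransversalE

variable {a b : ℝ} (B : BandBounds a b) {δ : (Fin 2 → ℝ) → ℝ} (hδs : ContDiff ℝ 2 δ)
  {κ₀ κ₁ κ₂ μ : ℝ} (hδ : ∀ k : Fin 2 → ℝ, |δ k| ≤ κ₀) (hlo : a ≤ μ - κ₀) (hhi : μ + κ₀ ≤ b)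
  (hκ : ∀ k : Fin 2 → ℝ, ‖fderiv ℝ δ k‖ ≤ κ₁) (hκ₁ : κ₁ < B.Dtmin) (hκ₂ : ∀ k : Fin 2 → ℝ, ‖fderiv ℝ (fderiv ℝ δ) k‖ ≤ κ₂)
  {u : ℝ → ℝ} (hu : ∀ θ, IsBandFermiRadius (μ - δ (u θ • dir θ)) θ (u θ))
include B hδs hδ hlo hhi hκ hκ₁ hκ₂ hu

/-- **The perturbed diagonal slope is Lipschitz**: `|2∂₃h^E(x,x) − 2∂₃h^E(x′,x′)| ≤ A_E·|x − x′|`, `A_E` the bound of `abs_diag_deriv2E_le`.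
[cite: BenfattoGiulianiMastropietro2006, Lemma 3.1 / App. A2] -/
theorem abs_two_h3E_diag_sub_le (P : ℝ × ℝ) (x x' : ℝ) :
    |2 * h3E δ u P x x - 2 * h3E δ u P x' x'| ≤ (16 * (B.smax + κ₁ * (π * Real.sqrt 2 + 2 * B.smax) / (B.Dtmin - κ₁)) ^ 2 + 8 * ((((4 + κ₂) * (B.smax + κ₁ * (π * Real.sqrt 2 + 2 * B.smax) / (B.Dtmin - κ₁)) ^ 2 + (8 + 2 * κ₁) * ((4 + κ₁) * (π * Real.sqrt 2) / (B.Dtmin - κ₁)) + (4 + κ₁) * (π * Real.sqrt 2)) / (B.Dtmin - κ₁)) + 2 * ((4 + κ₁) * (π * Real.sqrt 2) / (B.Dtmin - κ₁)) + π * Real.sqrt 2) + 4 * (κ₂ * (B.smax + κ₁ * (π * Real.sqrt 2 + 2 * B.smax) / (B.Dtmin - κ₁)) ^ 2) + 2 * (κ₁ * ((((4 + κ₂) * (B.smax + κ₁ * (π * Real.sqrt 2 + 2 * B.smax) / (B.Dtmin - κ₁)) ^ 2 + (8 + 2 * κ₁) * ((4 + κ₁) * (π * Real.sqrt 2) / (B.Dtmin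 - κ₁)) + (4 + κ₁) * (π * Real.sqrt 2)) / (B.Dtmin - κ₁)) + 2 * ((4 + κ₁) * (π * Real.sqrt 2) / (B.Dtmin - κ₁)) + π * Real.sqrt 2))) * |x - x'| := by
  have hd := hasDerivAt_two_h3E_diag B hδs hδ hlo hhi hκ hκ₁ hu P
  have h := Convex.norm_image_sub_le_of_norm_hasDerivWithin_le (fun t _ => (hd t).hasDerivWithinAt)
    (fun t _ => by rw [Real.norm_eq_abs]; exact abs_diag_deriv2E_le B hδs hδ hlo hhi hκ hκ₁ hκ₂ hu P t) (convex_uIcc x' x)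
    left_mem_uIcc right_mem_uIcc
  rw [Real.norm_eq_abs, Real.norm_eq_abs] at h
  exact h

/-- **Level count of the perturbed diagonal function on its transversal rows** (lemma L2): on a grid `x₀ + s·h`, `s < K`,
`#{s : |h^E_P(x_s, x_s)| ≤ η ∧ 2λ ≤ |2∂₃h^E_P(x_s, x_s)|} ≤ (K h/(2λ/(2A_E)) + 1)·2(4η/(2λ)/h + 1)` — linear in `η`, NO `√η`.
[cite: BenfattoGiulianiMastropietro2006, Lemma 3.1 / App. A2] -/
theorem count_levels_diagE_transversal {P : ℝ × ℝ} {x₀ h η lam : ℝ} (hh : 0 < h) (hη : 0 ≤ η) (hlam : 0 < lam)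
    (hAE : 0 < 16 * (B.smax + κ₁ * (π * Real.sqrt 2 + 2 * B.smax) / (B.Dtmin - κ₁)) ^ 2 + 8 * ((((4 + κ₂) * (B.smax + κ₁ * (π * Real.sqrt 2 + 2 * B.smax) / (B.Dtmin - κ₁)) ^ 2 + (8 + 2 * κ₁) * ((4 + κ₁) * (π * Real.sqrt 2) / (B.Dtmin - κ₁)) + (4 + κ₁) * (π * Real.sqrt 2)) / (B.Dtmin - κ₁)) + 2 * ((4 + κ₁) * (π * Real.sqrt 2) / (B.Dtmin - κ₁)) + π * Real.sqrt 2) + 4 * (κ₂ * (B.smax + κ₁ * (π * Real.sqrt 2 + 2 * B.smax) / (B.Dtmin - κ₁)) ^ 2) + 2 * (κ₁ * ((((4 + κ₂) * (B.smax + κ₁ * (π * Real.sqrt 2 + 2 * B.smax) / (B.Dtmin - κ₁)) ^ 2 + (8 + 2 * κ₁) * ((4 + κ₁) * (π * Real.sqrt 2) / (B.Dtmin - κ₁)) + (4 + κ₁) * (π * Real.sqrt 2)) / (B.Dtmin - κ₁)) + 2 * ((4 + κ₁) * (π * Real.sqrt 2) / (B.Dtmin - κ₁)) + π * Real.sqrt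 2))) (K : ℕ) :
    ((((Finset.range K).filter fun s : ℕ =>
        |hfunE δ u μ P (x₀ + s * h) (x₀ + s * h)| ≤ η ∧ 2 * lam ≤ |2 * h3E δ u P (x₀ + s * h) (x₀ + s * h)|).card : ℝ)) ≤
      (K * h / (2 * lam / (2 * (16 * (B.smax + κ₁ * (π * Real.sqrt 2 + 2 * B.smax) / (B.Dtmin - κ₁)) ^ 2 + 8 * ((((4 + κ₂) * (B.smax + κ₁ * (π * Real.sqrt 2 + 2 * B.smax) / (B.Dtmin - κ₁)) ^ 2 + (8 + 2 * κ₁) * ((4 + κ₁) * (π * Real.sqrt 2) / (B.Dtmin - κ₁)) + (4 + κ₁) * (π * Real.sqrt 2)) / (B.Dtmin - κ₁)) + 2 * ((4 + κ₁) * (π * Real.sqrt 2) / (B.Dtmin - κ₁)) + π * Real.sqrt 2) + 4 * (κ₂ * (B.smax + κ₁ * (π * Real.sqrt 2 + 2 * B.smax) / (B.Dtmin - κ₁)) ^ 2) + 2 * (κ₁ * ((((4 + κ₂) * (B.smax + κ₁ * (π * Real.sqrt 2 + 2 * B.smax) / (B.Dtmin - κ₁)) ^ 2 + (8 + 2 *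 κ₁) * ((4 + κ₁) * (π * Real.sqrt 2) / (B.Dtmin - κ₁)) + (4 + κ₁) * (π * Real.sqrt 2)) / (B.Dtmin - κ₁)) + 2 * ((4 + κ₁) * (π * Real.sqrt 2) / (B.Dtmin - κ₁)) + π * Real.sqrt 2))))) + 1) * (2 * ((4 * η / (2 * lam)) / h + 1)) :=
  gridCount_L2 (g := fun x => hfunE δ u μ P x x) (g' := fun x => 2 * h3E δ u P x x)
    (hasDerivAt_hfunE_diagZero B hδs hδ hlo hhi hκ hκ₁ hu P) (lam := 2 * lam) (δ := η)
    hAE (by positivity) hη (abs_two_h3E_diag_sub_le B hδs hδ hlo hhi hκ hκ₁ hκ₂ hu P) hh K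

end TransversalE

end Summit.HubbardSuperconductivity.HubbardSuperconductivity.Theorems.PerturbedFermiCurve

end
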